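import Summits.ABC.ABC.Theses.CongruentialReceptacle
import Summits.ABC.ABC.Theorems.CongruentialReceptacleQuarterWindowGivesCrux
import Summits.ABC.ABC.Theorems.CongruentialReceptacleAssembly
import Literature.NumberTheory.DiophantineGeometry.PastenSubexpTheorem14
import HarnessLib

/-!
# Thin-window rigidity: currency exchange into the logarithmic abc currency on a window `κ`

Stub `stub_thinWindowCurrencyIn` of the line `Descent` (card `balance-window-descent`) for the crux
stmt-ABC-1723 `BalancedFreySzpiro` (Szpiro `6+ε` in the elementary currency
`(abc)² ≤ C · rad(abc)^(6+ε)` for balanced abc triples).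

The line works internally in the logarithmic abc currency `log c ≤ K + (1+ε) · log rad(abc)`.
This file is the exchange INTO that currency on an arbitrary balance window `κ > 0`:
from `κc ≤ a`, `κc ≤ b` one has `κ⁴ c⁶ ≤ (abc)²` (`balanced_pow_six_le`), so
`κ⁴ c⁶ ≤ (abc)² ≤ C · rad^(6+ε) ≤ max(C,1) · rad^(6+ε)`; taking logarithms (everything is positive:
`c > 0` from the triple, `rad ≥ 1`, `max(C,1) > 0`) gives
`4 log κ + 6 log c ≤ log max(C,1) + (6+ε) · log rad`, i.e.
`log c ≤ (log max(C,1) − 4 log κ)/6 + (1 + ε/6) · log rad ≤ (…)/6 + (1+ε) · log rad`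
because `log rad ≥ 0` and `ε > 0`. This is the general-`κ` version of
`log_window_of_szpiro_window` (the instance `κ = 1/4`).
-/

-- `Summit.<Summit>.<Problem>` is the mandated summit-side namespace (CONVENTIONS §2); for the
-- single-conjunct summit `ABC` the two coincide, so the duplicate `ABC.ABC` is deliberate.
set_option linter.dupNamespace false

noncomputable section

open Real
open Literature.NumberTheory.DiophantineGeometry
open Summit.ABC.ABC.Theses.CongruentialReceptacle

namespace Summit.ABC.ABC.Theorems

/-- **Currency in, on an arbitrary window `κ > 0`.** For an abc triple with `κc ≤ a`, `κc ≤ b`,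
Szpiro's bound `(abc)² ≤ C · rad^(6+ε)` gives the logarithmic abc bound
`log c ≤ (log max(C,1) − 4 log κ)/6 + (1+ε) · log rad(abc)`, because `κ⁴ c⁶ ≤ (abc)²` on the
window (`balanced_pow_six_le`) and `log rad(abc) ≥ 0`. [folklore] -/
theorem stub_thinWindowCurrencyIn {κ C ε : ℝ} (hκ : 0 < κ) (hε : 0 < ε) {a b c : ℕ}
    (h : IsABCTriple a b c) (ha : κ * (c : ℝ) ≤ (a : ℝ)) (hb : κ * (c : ℝ) ≤ (b : ℝ))
    (hS : ((a * b * c : ℕ) : ℝ) ^ 2 ≤ C * ((rad a b c : ℕ) : ℝ) ^ (6 + ε)) :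
    Real.log (c : ℝ) ≤ (Real.log (max C 1) - 4 * Real.log κ) / 6
      + (1 + ε) * Real.log ((rad a b c : ℕ) : ℝ) := by
  obtain ⟨ha0, -, habc, -⟩ := h
  have hcpos : (0 : ℝ) < c := by
    have h0 : 0 < c := by omega
    exact_mod_cast h0
  have hr0 : 0 < rad a b c := Nat.radical_pos _
  have hrpos : (0 : ℝ) < ((rad a b c : ℕ) : ℝ) := by exact_mod_cast hr0
  have hR0 : 0 ≤ Real.log ((rad a b c : ℕ) : ℝ) :=
    Real.log_nonneg (by exact_mod_cast Nat.one_le_iff_ne_zero.mpr hr0.ne')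
  have hMpos : (0 : ℝ) < max C 1 := lt_of_lt_of_le one_pos (le_max_right _ _)
  -- the window bound `κ⁴ c⁶ ≤ (abc)²` and the chain up to `max(C,1) · rad^(6+ε)`
  have hlow : κ ^ 4 * (c : ℝ) ^ 6 ≤ ((a * b * c : ℕ) : ℝ) ^ 2 :=
    balanced_pow_six_le hκ.le ha hb
  have hM : C * ((rad a b c : ℕ) : ℝ) ^ (6 + ε) ≤ max C 1 * ((rad a b c : ℕ) : ℝ) ^ (6 + ε) :=
    mul_le_mul_of_nonneg_right (le_max_left _ _) (Real.rpow_nonneg hrpos.le _)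
  have hchain := hlow.trans (hS.trans hM)
  -- take logarithms: `4 log κ + 6 log c ≤ log max(C,1) + (6+ε) log rad`
  have hlog := Real.log_le_log (by positivity) hchain
  rw [Real.log_mul (by positivity) (by positivity), Real.log_pow, Real.log_pow,
    Real.log_mul hMpos.ne' (Real.rpow_pos_of_pos hrpos _).ne', Real.log_rpow hrpos] at hlog
  push_cast at hlog
  -- weaken the slope `1 + ε/6` to `1 + ε` using `log rad ≥ 0`
  have hslope : (1 + ε / 6) * Real.log ((rad a b c : ℕ) : ℝ)
      ≤ (1 + ε) * Real.log ((rad a b c : ℕ) : ℝ) :=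
    mul_le_mul_of_nonneg_right (by linarith) hR0
  linarith

end Summit.ABC.ABC.Theorems

end
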